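import Mathlib
import Summits.ValiantsHypothesis.ValiantsHypothesis.Theorems.FifoMatchingNNLinearDegreeCofactorHardAvoidingCounts
import Summits.ValiantsHypothesis.ValiantsHypothesis.Theorems.FifoMatchingNNLinearDegreeCofactorHardCountsGlue
import HarnessLib

/-!
# Route `FifoMatching`, crux `NNLinearDegreeCofactorHard` (stmt-ValiantsHypothesis-23918), line `internal_cofactor`:
# the INTERFACE of the μ* programme — AvoidingCounts 28 from a PRICING of respecting words

LEAD p2's assembly unit (split of record, director-valiant g11 R42).  The μ* = `shedWord` programme (p1 U1–U5, c1, c2; see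
`Cruxes/NNLinearDegreeCofactorHard/Lines/internal_cofactor-S2b-LEAD-HANDOFF.md` §p2 and the two specs `…-Dstar3-attribution-p2.md`,
`…-Dstar24-geometry-p2.md`) delivers, for every admissible instance (carved window `2·C.m`, defects `R′`), a seed set `BB` of bit
strings, a map `f` into the R′-avoiding nest-free perfect matchings, a BAND count `2^B ≤ 2·#BB`, and for every balanced split `S` a
PRICING `#{y ∈ BB : f y respects S} · (4/3)^{r(C.m)} ≤ 2^B` with a rate `r` (from the heart: tests + passages `≥ r(C.m)`, priced by
`CondProbBits.card_mul_le_of_passages`).  This file fixes that interface once and proves that it suffices: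

* `avoidingCounts28_of_pricing` — PRICING (for a rate `r`) + the growth condition
  «`8·(2^((log₂ n + c)^c) + 1)·(M+1)²·(3/4)^{r M} < 1` for `n ≤ 14(M+2)`, eventually in `n`» ⇒ the hypothesis of
  `denseInternalHard_of_counts 28` VERBATIM (via `CondProbBits.counts_of_pricing`);
* the crux then follows BY NAME in one line, `nnLinearDegreeCofactorHard_of_avoidingCounts28 (avoidingCounts28_of_pricing r hμ hr)`
  (p599455; kept out of this route-independent file so that route edits do not rebuild it), and the exponent-2 rung stmt-24468 via
  `quasiPolyHard_of_counts` from the same pricing with `K = 2^((log₂ n)²/b)`.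

Honest framing: a CONDITIONAL assembly; neither the pricing nor the growth condition is proved here (they are the pool's open units
U5 / c2 / `stub_params`); nothing here proves S2b, the crux, `NNDivisionHard`, `NNNotVP` or VP ≠ VNP (NOT proved); monotone world
only.  No definitions, no named facts.
-/

noncomputable section

-- Sub = Summit single-conjunct layout: the duplicated namespace component is mandated by the tree.
set_option linter.dupNamespace false

namespace Summit.ValiantsHypothesis.ValiantsHypothesis.Theorems.FifoMatching.NNLinearDegreeCofactorHard.InternalCofactor

open MvPolynomial Finset Literature.Computability.AlgebraicComplexity
open Summit.ValiantsHypothesis.ValiantsHypothesis.Theorems.FifoMatching.NNLowDegreeCofactorHard.FreedVertices.Carve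
open Summit.ValiantsHypothesis.ValiantsHypothesis.Theorems.FifoMatching.NNLinearDegreeCofactorHard.CondProbBits
open scoped NNReal

/-- **AvoidingCounts 28 from a pricing.**  Suppose that for every `n`, every `R` with `28·|R| ≤ 2n`, every carving `C` with
`3 ≤ C.m`, `2n ≤ 2·C.m + 12·|R| + 4` and good ends there are `B`, a nonempty `BB ⊆ {0,1}^B` and `f : {0,1}^B → (matchings)` with
`f(BB) ⊆ 𝓕_{R′}`, the band count `2^B ≤ 2·#BB`, and the pricing `#{y ∈ BB : f y respects S}·(4/3)^{r(C.m)} ≤ 2^B` for every balanced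
`S`; and suppose the rate `r` beats the threshold: for every `c`, eventually in `n`, `8(2^((log₂ n+c)^c)+1)(M+1)²(3/4)^{r M} < 1`
whenever `n ≤ 14(M+2)`.  Then the counts hypothesis of `denseInternalHard_of_counts 28` holds. [folklore] -/
theorem avoidingCounts28_of_pricing (r : ℕ → ℕ)
    (hμ : ∀ n : ℕ, ∀ R : Finset (Fin (2 * n)), 28 * R.card ≤ 2 * n →
      ∀ C : Carving n, 3 ≤ C.m → 2 * n ≤ 2 * C.m + 12 * R.card + 4 →
        (∀ t ≤ 2 * C.m,
          4 * ((univ.filter fun j : Fin (2 * C.m) => C.up j ∈ R).filter fun j => j.val < t).card ≤ t ∧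
          4 * ((univ.filter fun j : Fin (2 * C.m) => C.up j ∈ R).filter
            fun j => 2 * C.m ≤ j.val + t).card ≤ t) →
        ∃ B : ℕ, ∃ BB : Finset (Fin B → Bool), ∃ f : (Fin B → Bool) → (Fin (2 * C.m) → Fin (2 * C.m)),
          BB.Nonempty ∧
          (∀ y ∈ BB, f y ∈ (nestFreeMatchings (2 * C.m)).filter
            (fun N => ∀ j ∈ (univ.filter fun j : Fin (2 * C.m) => C.up j ∈ R),
              N j ∉ (univ.filter fun j : Fin (2 * C.m) => C.up j ∈ R))) ∧
          (2 : ℝ) ^ B ≤ 2 * BB.card ∧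
          ∀ S : Finset (Fin (2 * C.m)), 2 * C.m < 3 * S.card → 3 * S.card ≤ 4 * C.m →
            ((BB.filter fun y => ∀ i, i ∈ S ↔ f y i ∈ S).card : ℝ) * (4 / 3 : ℝ) ^ (r C.m) ≤ 2 ^ B)
    (hr : ∀ c : ℕ, ∃ n₀ : ℕ, ∀ n ≥ n₀, ∀ M : ℕ, n ≤ 14 * (M + 2) →
      (8 * (2 ^ ((Nat.log 2 n + c) ^ c) + 1) * (M + 1) ^ 2 : ℝ) * (3 / 4 : ℝ) ^ (r M) < 1) :
    ∀ c : ℕ, ∃ n₀ : ℕ, ∀ n ≥ n₀, ∀ R : Finset (Fin (2 * n)), 28 * R.card ≤ 2 * n →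
      (¬ ∃ s : ℕ, s + (2 * ((Nat.log 2 n + c) ^ c + Nat.log 2 n + 1) ^ 6 + 12) ≤ 2 * n ∧
        ∀ j : Fin (2 * n), s ≤ j.val →
          j.val < s + (2 * ((Nat.log 2 n + c) ^ c + Nat.log 2 n + 1) ^ 6 + 12) → j ∉ R) →
      ∀ C : Carving n, 3 ≤ C.m → 2 * n ≤ 2 * C.m + 12 * R.card + 4 →
        (∀ t ≤ 2 * C.m,
          4 * ((univ.filter fun j : Fin (2 * C.m) => C.up j ∈ R).filter fun j => j.val < t).card ≤ t ∧
          4 * ((univ.filter fun j : Fin (2 * C.m) => C.up j ∈ R).filter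
            fun j => 2 * C.m ≤ j.val + t).card ≤ t) →
        ∃ B : ℕ, ∃ BB : Finset (Fin B → Bool), ∃ f : (Fin B → Bool) → (Fin (2 * C.m) → Fin (2 * C.m)),
          BB.Nonempty ∧
          (∀ y ∈ BB, f y ∈ (nestFreeMatchings (2 * C.m)).filter
            (fun N => ∀ j ∈ (univ.filter fun j : Fin (2 * C.m) => C.up j ∈ R),
              N j ∉ (univ.filter fun j : Fin (2 * C.m) => C.up j ∈ R))) ∧
          ∀ S : Finset (Fin (2 * C.m)), 2 * C.m < 3 * S.card → 3 * S.card ≤ 4 * C.m →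
            (4 * (2 ^ ((Nat.log 2 n + c) ^ c) + 1) * (C.m + 1) ^ 2) *
              (BB.filter fun y => ∀ i, i ∈ S ↔ f y i ∈ S).card < BB.card := by
  intro c
  obtain ⟨n₀, hn₀⟩ := hr c
  refine ⟨n₀, fun n hn R hR _ C hm hnC hends => ?_⟩
  obtain ⟨B, BB, f, hne, hsupp, hband, hprice⟩ := hμ n R hR C hm hnC hends
  refine ⟨B, BB, f, hne, hsupp, fun S hS1 hS2 => ?_⟩
  have hM : n ≤ 14 * (C.m + 2) := by omega
  have har := hn₀ n hn C.m hM
  have har' : (8 * ((2 ^ ((Nat.log 2 n + c) ^ c) : ℕ) + 1) * (C.m + 1) ^ 2 : ℝ) * (3 / 4 : ℝ) ^ (r C.m) < 1 := by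
    push_cast
    exact har
  have key := counts_of_pricing (K := 2 ^ ((Nat.log 2 n + c) ^ c)) (hprice S hS1 hS2) hband har'
  simpa [mul_assoc] using key

end Summit.ValiantsHypothesis.ValiantsHypothesis.Theorems.FifoMatching.NNLinearDegreeCofactorHard.InternalCofactor

end
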